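import Literature.Geometry.Riemannian.SphericalCylinderEntropy
import Mathlib.Analysis.Convex.Function
import Mathlib.Analysis.SpecialFunctions.Log.Basic
import HarnessLib

/-!
# Hamilton's matrix Harnack estimate for the heat kernel of the round `S⁴`: logarithmic convexity along
# great circles (NAMED FACT)

Topic `Literature/Geometry/Riemannian`.  R. S. Hamilton, *A matrix Harnack estimate for the heat equation*,
Comm. Anal. Geom. **1** (1993) 113–126, Main Theorem: on a compact Riemannian manifold `M` that is Ricci
parallel with weakly positive sectional curvatures, every positive solution `f > 0` of the heat equation on
`0 < t < ∞` satisfies `DᵢDⱼf + f gᵢⱼ/(2t) + Dᵢf Vⱼ + Dⱼf Vᵢ + f VᵢVⱼ ≥ 0` for every vector field `V`; with the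
optimal `V = -Df/f` this is `DᵢDⱼ log f + gᵢⱼ/(2t) ≥ 0`, and (ibid. p. 114) "along any geodesic `x(s)`
parametrized by arc length `s` … `log f + s²/4t` is convex"; "the hypothesis … is satisfied on … a sphere".

We record the instance the tree can state: `M` = the unit round `S⁴` (`sec ≡ 1`, `Ric = 3g` parallel),
`f(·, t) = p_t(·, y)` the heat kernel (the strictly positive `C^∞` integral kernel of `e^{tΔ}` on
`(0,∞) × M × M`, Davies 1989 Thm 5.2.1), and the great circle `x(s)` through `y`, along which `⟨x(s), y⟩ = cos s`.
By the spectral expansion of the heat kernel and the addition theorem for spherical harmonics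
(eigenvalue `k(k+3)` on the degree-`k` harmonics `H_k` of `S⁴`; `∑_{Y ∈ ONB(H_k)} Y(x)Y(y) =
(dim H_k / vol S⁴) · C_k^{(3/2)}(⟨x,y⟩)/C_k^{(3/2)}(1)` with `dim H_k / C_k^{(3/2)}(1) = (2k+3)/3`;
Andrews–Askey–Roy Thm 9.6.3, Stein–Weiss IV.2, Efthimiou–Frye Ch. 4)
`vol(S⁴) · p_t(x, y) = ∑_k e^{-k(k+3)t} (2k+3)/3 · C_k^{(3/2)}(⟨x,y⟩) = zonal t ⟨x,y⟩`, the tree's typed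
series `Literature.Geometry.Riemannian.SphericalCylinderEntropy.zonal` (absolutely convergent for every
`t > 0`: `Literature.Geometry.Riemannian.SphericalZonalKernelSeries.summable_wt_mul_gegen`).  Hence the fact
below — positivity of `s ↦ zonal t (cos s)` and convexity of `s ↦ log (zonal t (cos s)) + s²/(4t)` on
`[-π, π]` (`log vol(S⁴)` is an additive constant) — is Hamilton's corollary as printed, for this `M` and `f`.

It is the hypothesis `stub_hamiltonConvex` of line `ball-mass-slack` of the crux
`CylinderEntropy.ThinCrossSectionExists` (route `SmoothPoincare4/CylinderEntropy`): with it, the landed stubs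
`stub_harnackRadial_of_convex`, `stub_zonalMonotone` (proved), `stub_kernelDomination`, `stub_levelComparison`,
`stub_layerCakeCore` give the lever `λ_cyl(S) ≤ m_N(S) · λ_cyl(slice)` for every subset `S` of `S⁴ × ℝ`.
Numerical sanity (three refuter triage seats + planner, Gegenbauer series with ≥ √(60/τ)+12 modes,
τ ∈ [0.02, 5]): `min_θ (2τ ∂²_θ log zonal τ (cos θ) + 1) > 0` with margin `≈ τ(1 - O(τ))`, 0 violations.

NOT here: Hamilton's theorem for general `(M, f, V)` (no Riemannian Hessian / heat equation on manifolds in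
Mathlib) — `-- TODO(general form)`; a proof (maximum principle for Hamilton's quantity, or a 1-D radial
Li–Yau–Hamilton argument on the ultraspherical heat equation `u_t = u_θθ + 3 cot θ · u_θ` now available through
`Literature.Geometry.Riemannian.SphericalZonalKernelSeriesDeriv`); the discharge `…_holds` is literature-prover work.

## References
* R. S. Hamilton, *A matrix Harnack estimate for the heat equation*, Comm. Anal. Geom. 1 (1993) 113–126,
  Main Theorem and p. 114. [Hamilton1993Harnack]
* E. B. Davies, *Heat Kernels and Spectral Theory*, CUP 1989, Thm 5.2.1 (strict positivity). [Davies1989]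
* G. E. Andrews, R. Askey, R. Roy, *Special Functions*, CUP 1999, Thm 9.6.3 (addition theorem). [AndrewsAskeyRoy1999]
* E. M. Stein, G. Weiss, *Introduction to Fourier Analysis on Euclidean Spaces*, 1971, Ch. IV §2. [SteinWeiss1971]
* C. Efthimiou, C. Frye, *Spherical Harmonics in p Dimensions*, 2014, Ch. 4. [EfthimiouFrye2014]
-/

noncomputable section

namespace Literature.Geometry.Riemannian.SphereHeatKernelHarnack

open Literature.Geometry.Riemannian.SphericalCylinderEntropy (zonal)

/-- **Hamilton's logarithmic convexity for the heat kernel of the round `S⁴`, radial form (NAMED FACT).**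
For every `τ > 0`: the zonal heat kernel `θ ↦ zonal τ (cos θ) = vol(S⁴)·p_τ(x(θ), y)` along a great circle
through `y` is strictly positive, and `θ ↦ log (zonal τ (cos θ)) + θ²/(4τ)` is convex on `[-π, π]` — the
corollary "`log f + s²/4t` is convex along any arc-length geodesic" of Hamilton's matrix Harnack estimate
`DᵢDⱼ log f + gᵢⱼ/(2t) ≥ 0` (compact, Ricci parallel, weakly positive sectional curvature; satisfied by the round
sphere) applied to the positive solution `f = p_t(·, y)`, written on the tree's typed Gegenbauer series `zonal`
(`vol(S⁴)·p_t(x,y) = zonal t ⟨x,y⟩` by the spectral expansion and the addition theorem; strict positivity of the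
kernel: Davies 1989 Thm 5.2.1).  Users: line `ball-mass-slack` of `CylinderEntropy.ThinCrossSectionExists`
(stub `stub_hamiltonConvex`).
-- TODO(general form): the matrix inequality for every compact Ricci-parallel `M` with `sec ≥ 0`, every
-- positive solution `f` and every vector field `V` (needs Riemannian Hessians / heat equation on manifolds).
[cite: Hamilton1993Harnack, Main Theorem and p. 114 (log f + s²/4t convex along geodesics)] -/
def HamiltonLogConvexSphereFour : Prop :=
  ∀ τ : ℝ, 0 < τ →
    (∀ θ : ℝ, 0 < zonal τ (Real.cos θ)) ∧
      ConvexOn ℝ (Set.Icc (-Real.pi) Real.pi)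
        (fun θ : ℝ => Real.log (zonal τ (Real.cos θ)) + θ ^ 2 / (4 * τ))

end Literature.Geometry.Riemannian.SphereHeatKernelHarnack

end
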